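import Summits.AtomisticToContinuum.Crystallization.Theorems.OverbindingBudgetAffineFarStraighteningCaps

/-!
# D-C (order) · DEPTH FORM, RADIAL ORDERING AND PARENT — lens-4 g59 (DEV brick for `RaffDevelopment`)

`Summit.AtomisticToContinuum.Crystallization`, family `OverbindingBudgetAffineFarSmoothSplit`; memo NODE-g59-DevSpec §1 (ORD), (PAR).
The development of the `ρ`-ball (DEV) proceeds by induction on the distance `D_m = ‖y m − y i‖` to the centre.  At a site `n` with
near-conformal frame `s • A` (`‖A v − Q v‖ ≤ τ‖v‖`, `Q` a linear isometry, `s = nn_n`) and `Y := y n − y i`, a pattern label `u` points to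
the site `j` with `‖(y j − y i) − (Y + s • A u)‖ ≤ δ₀` (the fit).
This file is the LOCAL arithmetic of the order (no development error enters):

* §1 the exact DEPTH FORM `-(A†) Y` (`LinearMap.adjoint`): `⟪−A† Y, u⟫ = −⟪Y, A u⟫` (`inner_depthForm`) and its size
  `(1 − τ)‖Y‖ ≤ ‖A† Y‖ ≤ (1 + τ)‖Y‖` (`norm_adjoint_ge`, `norm_adjoint_le`);
* §2 the ORDERING identity and its two consequences (`normSq_step_le`, `normSq_step_ge`, `nearer_of_deep`, `deep_of_notFarther`):
  `‖z‖² = ‖Y‖² + 2⟪Y, w⟫ + ‖w‖² ± (2‖Y + w‖ + δ₀)·δ₀` for `‖z − (Y + w)‖ ≤ δ₀`, so a label deeper than `‖w‖²/2 + fuzz` points to a site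
  STRICTLY NEARER to the centre (developed earlier), and a site not farther than `n` has depth `≥ ‖w‖²/2 − fuzz`;
* §3 the PARENT: `exists_deep_label` — some unit label `u ∈ P` has `(1 − τ)‖Y‖ ≤ √2·(−⟪Y, A u⟫)` (`exists_deep_of_twoShell` applied to the
  depth form), and `parent_nearer` — with `s ≤ ‖Y‖`, `τ ≤ 1/20` and fuzz `(2‖Y‖ + 3s)·δ₀ ≤ s²/5` its site is strictly nearer (margin `s²/20`).
-/

namespace Summit.AtomisticToContinuum.Crystallization.Theorems.OverbindingBudgetAffineFarSmoothSplit

open Literature.Geometry.DiscreteGeometry (fccTwoShellPattern hcpTwoShellPattern)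
open scoped RealInnerProductSpace

/-! ## §1  The depth form -/

/-- The depth form pairs with a label as minus the radial component of its frame image. [this file; Mathlib `LinearMap.adjoint_inner_left`] -/
theorem inner_depthForm (A : EuclideanSpace ℝ (Fin 3) →ₗ[ℝ] EuclideanSpace ℝ (Fin 3)) (Y u : EuclideanSpace ℝ (Fin 3)) :
    ⟪-(LinearMap.adjoint A Y), u⟫ = -⟪Y, A u⟫ := by
  rw [inner_neg_left, LinearMap.adjoint_inner_left]

/-- Lower bound for the adjoint of a near-conformal frame: `(1 − τ)‖Y‖ ≤ ‖A† Y‖` (test against `v := Q⁻¹ Y`). [this file] -/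
theorem norm_adjoint_ge {A : EuclideanSpace ℝ (Fin 3) →ₗ[ℝ] EuclideanSpace ℝ (Fin 3)}
    {Q : EuclideanSpace ℝ (Fin 3) →ₗᵢ[ℝ] EuclideanSpace ℝ (Fin 3)} {τ : ℝ} (hA : ∀ v, ‖A v - Q v‖ ≤ τ * ‖v‖)
    (Y : EuclideanSpace ℝ (Fin 3)) : (1 - τ) * ‖Y‖ ≤ ‖LinearMap.adjoint A Y‖ := by
  let Qe : EuclideanSpace ℝ (Fin 3) ≃ₗᵢ[ℝ] EuclideanSpace ℝ (Fin 3) := Q.toLinearIsometryEquiv rfl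
  set v := Qe.symm Y with hv
  have hQv : Q v = Y := by
    show (Qe : EuclideanSpace ℝ (Fin 3) → EuclideanSpace ℝ (Fin 3)) (Qe.symm Y) = Y
    exact Qe.apply_symm_apply _
  have hvn : ‖v‖ = ‖Y‖ := by rw [hv, LinearIsometryEquiv.norm_map]
  -- `⟪Y, A v⟫ = ‖Y‖² + ⟪Y, A v − Q v⟫ ≥ ‖Y‖² − τ‖Y‖²`
  have h1 : ⟪Y, A v⟫ = ‖Y‖ ^ 2 + ⟪Y, A v - Q v⟫ := by
    rw [inner_sub_right, hQv, real_inner_self_eq_norm_sq]; ring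
  have h2 : ⟪Y, A v - Q v⟫ ≥ -(τ * ‖Y‖ * ‖Y‖) := by
    have h := abs_real_inner_le_norm Y (A v - Q v)
    have h' := hA v
    rw [hvn] at h'
    have : |⟪Y, A v - Q v⟫| ≤ ‖Y‖ * (τ * ‖Y‖) := h.trans (mul_le_mul_of_nonneg_left h' (norm_nonneg _))
    have := (abs_le.mp this).1
    linarith
  have h3 : ⟪Y, A v⟫ ≤ ‖LinearMap.adjoint A Y‖ * ‖Y‖ := by
    have h := real_inner_le_norm (LinearMap.adjoint A Y) v
    rw [LinearMap.adjoint_inner_left, hvn] at h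
    exact h
  by_cases hY : ‖Y‖ = 0
  · rw [hY, mul_zero]; exact norm_nonneg _
  · have hYpos : 0 < ‖Y‖ := lt_of_le_of_ne (norm_nonneg _) (Ne.symm hY)
    have hsq : ‖Y‖ ^ 2 = ‖Y‖ * ‖Y‖ := sq ‖Y‖
    have h4 : (1 - τ) * ‖Y‖ * ‖Y‖ ≤ ‖LinearMap.adjoint A Y‖ * ‖Y‖ := by nlinarith
    exact le_of_mul_le_mul_right h4 hYpos

/-- Upper bound for the adjoint of a near-conformal frame: `‖A† Y‖ ≤ (1 + τ)‖Y‖`. [this file] -/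
theorem norm_adjoint_le {A : EuclideanSpace ℝ (Fin 3) →ₗ[ℝ] EuclideanSpace ℝ (Fin 3)}
    {Q : EuclideanSpace ℝ (Fin 3) →ₗᵢ[ℝ] EuclideanSpace ℝ (Fin 3)} {τ : ℝ} (hτ : 0 ≤ τ) (hA : ∀ v, ‖A v - Q v‖ ≤ τ * ‖v‖)
    (Y : EuclideanSpace ℝ (Fin 3)) : ‖LinearMap.adjoint A Y‖ ≤ (1 + τ) * ‖Y‖ := by
  set d := LinearMap.adjoint A Y with hd
  have hAd : ‖A d‖ ≤ (1 + τ) * ‖d‖ := by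
    calc ‖A d‖ = ‖Q d + (A d - Q d)‖ := by rw [add_sub_cancel]
      _ ≤ ‖Q d‖ + ‖A d - Q d‖ := norm_add_le _ _
      _ ≤ ‖d‖ + τ * ‖d‖ := by rw [LinearIsometry.norm_map]; exact add_le_add le_rfl (hA d)
      _ = (1 + τ) * ‖d‖ := by ring
  have h1 : ‖d‖ ^ 2 = ⟪Y, A d⟫ := by
    rw [← LinearMap.adjoint_inner_left, ← hd, real_inner_self_eq_norm_sq]
  have h2 : ⟪Y, A d⟫ ≤ ‖Y‖ * ((1 + τ) * ‖d‖) :=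
    (real_inner_le_norm _ _).trans (mul_le_mul_of_nonneg_left hAd (norm_nonneg _))
  by_cases hd0 : ‖d‖ = 0
  · rw [hd0]; positivity
  · have hdpos : 0 < ‖d‖ := lt_of_le_of_ne (norm_nonneg _) (Ne.symm hd0)
    nlinarith [norm_nonneg Y]

/-! ## §2  The ordering identity and its consequences -/

/-- Two-sided control of `‖z‖²` by the frame step: upper half. [this file] -/
theorem normSq_step_le {Y w z : EuclideanSpace ℝ (Fin 3)} {δ₀ : ℝ} (hz : ‖z - (Y + w)‖ ≤ δ₀) :
    ‖z‖ ^ 2 ≤ ‖Y‖ ^ 2 + 2 * ⟪Y, w⟫ + ‖w‖ ^ 2 + (2 * ‖Y + w‖ + δ₀) * δ₀ := by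
  have hδ : 0 ≤ δ₀ := (norm_nonneg _).trans hz
  set e := z - (Y + w) with he
  have hz' : z = (Y + w) + e := by rw [he]; abel
  have hexp : ‖z‖ ^ 2 = ‖Y + w‖ ^ 2 + 2 * ⟪Y + w, e⟫ + ‖e‖ ^ 2 := by
    rw [hz']; exact norm_add_sq_real _ _
  have hYw : ‖Y + w‖ ^ 2 = ‖Y‖ ^ 2 + 2 * ⟪Y, w⟫ + ‖w‖ ^ 2 := norm_add_sq_real _ _
  have hin : ⟪Y + w, e⟫ ≤ ‖Y + w‖ * δ₀ := (real_inner_le_norm _ _).trans (mul_le_mul_of_nonneg_left hz (norm_nonneg _))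
  have he2 : ‖e‖ ^ 2 ≤ δ₀ * δ₀ := by rw [sq]; exact mul_le_mul hz hz (norm_nonneg _) hδ
  nlinarith

/-- Two-sided control of `‖z‖²` by the frame step: lower half. [this file] -/
theorem normSq_step_ge {Y w z : EuclideanSpace ℝ (Fin 3)} {δ₀ : ℝ} (hz : ‖z - (Y + w)‖ ≤ δ₀) :
    ‖Y‖ ^ 2 + 2 * ⟪Y, w⟫ + ‖w‖ ^ 2 - (2 * ‖Y + w‖ + δ₀) * δ₀ ≤ ‖z‖ ^ 2 := by
  have hδ : 0 ≤ δ₀ := (norm_nonneg _).trans hz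
  set e := z - (Y + w) with he
  have hz' : z = (Y + w) + e := by rw [he]; abel
  have hexp : ‖z‖ ^ 2 = ‖Y + w‖ ^ 2 + 2 * ⟪Y + w, e⟫ + ‖e‖ ^ 2 := by
    rw [hz']; exact norm_add_sq_real _ _
  have hYw : ‖Y + w‖ ^ 2 = ‖Y‖ ^ 2 + 2 * ⟪Y, w⟫ + ‖w‖ ^ 2 := norm_add_sq_real _ _
  have hin : -(‖Y + w‖ * δ₀) ≤ ⟪Y + w, e⟫ := by
    have h := abs_real_inner_le_norm (Y + w) e
    have : |⟪Y + w, e⟫| ≤ ‖Y + w‖ * δ₀ := h.trans (mul_le_mul_of_nonneg_left hz (norm_nonneg _))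
    exact (abs_le.mp this).1
  nlinarith [sq_nonneg ‖e‖]

/-- (ORD ⇒) A label deeper than `‖w‖²/2 + fuzz` points to a site strictly nearer to the centre. [this file] -/
theorem nearer_of_deep {Y w z : EuclideanSpace ℝ (Fin 3)} {δ₀ : ℝ} (hz : ‖z - (Y + w)‖ ≤ δ₀)
    (hdeep : ‖w‖ ^ 2 + (2 * ‖Y + w‖ + δ₀) * δ₀ < -(2 * ⟪Y, w⟫)) : ‖z‖ < ‖Y‖ := by
  have h := normSq_step_le hz
  have hsq : ‖z‖ ^ 2 < ‖Y‖ ^ 2 := by linarith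
  exact lt_of_pow_lt_pow_left₀ 2 (norm_nonneg _) hsq

/-- (ORD ⇐) A site not farther than `n` from the centre carries a label of depth at least `‖w‖²/2 − fuzz`. [this file] -/
theorem deep_of_notFarther {Y w z : EuclideanSpace ℝ (Fin 3)} {δ₀ : ℝ} (hz : ‖z - (Y + w)‖ ≤ δ₀) (hle : ‖z‖ ≤ ‖Y‖) :
    ‖w‖ ^ 2 - (2 * ‖Y + w‖ + δ₀) * δ₀ ≤ -(2 * ⟪Y, w⟫) := by
  have h := normSq_step_ge hz
  have hsq : ‖z‖ ^ 2 ≤ ‖Y‖ ^ 2 := pow_le_pow_left₀ (norm_nonneg _) hle 2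
  linarith

/-- (ORD, contrapositive) a site strictly farther than `n` carries a label of depth at most `‖w‖²/2 + fuzz`. [this file] -/
theorem shallow_of_farther {Y w z : EuclideanSpace ℝ (Fin 3)} {δ₀ : ℝ} (hz : ‖z - (Y + w)‖ ≤ δ₀) (hle : ‖Y‖ ≤ ‖z‖) :
    -(2 * ⟪Y, w⟫) ≤ ‖w‖ ^ 2 + (2 * ‖Y + w‖ + δ₀) * δ₀ := by
  have h := normSq_step_le hz
  have hsq : ‖Y‖ ^ 2 ≤ ‖z‖ ^ 2 := pow_le_pow_left₀ (norm_nonneg _) hle 2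
  linarith

/-! ## §3  The parent -/

/-- (PAR, pattern half) Some unit label is deep: `(1 − τ)‖Y‖ ≤ √2 · (−⟪Y, A u⟫)` — `exists_deep_of_twoShell` on the depth form `−A† Y`.
[this file; tree CAPS `exists_deep_of_twoShell`] -/
theorem exists_deep_label {P : Finset (EuclideanSpace ℝ (Fin 3))} (hP : P = fccTwoShellPattern ∨ P = hcpTwoShellPattern)
    {A : EuclideanSpace ℝ (Fin 3) →ₗ[ℝ] EuclideanSpace ℝ (Fin 3)} {Q : EuclideanSpace ℝ (Fin 3) →ₗᵢ[ℝ] EuclideanSpace ℝ (Fin 3)} {τ : ℝ}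
    (hA : ∀ v, ‖A v - Q v‖ ≤ τ * ‖v‖) (Y : EuclideanSpace ℝ (Fin 3)) :
    ∃ u ∈ P, ‖u‖ = 1 ∧ (1 - τ) * ‖Y‖ ≤ Real.sqrt 2 * (-⟪Y, A u⟫) := by
  obtain ⟨u, hu, hu1, hdeep⟩ := exists_deep_of_twoShell hP (-(LinearMap.adjoint A Y))
  refine ⟨u, hu, hu1, ?_⟩
  rw [inner_depthForm, norm_neg] at hdeep
  exact (norm_adjoint_ge hA Y).trans hdeep

/-- (PAR, metric half) The deep label's site is STRICTLY nearer to the centre: with frame scale `0 < s ≤ ‖Y‖` (the centre is a site, so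
`nn_n ≤ D`), `τ ≤ 1/20`, step `w = s • A u` for a unit `u` with `(1 − τ)‖Y‖ ≤ √2·(−⟪Y, A u⟫)`, and fuzz `(2‖Y‖ + 3s)·δ₀ ≤ s²/5`.
[this file] -/
theorem parent_nearer {A : EuclideanSpace ℝ (Fin 3) →ₗ[ℝ] EuclideanSpace ℝ (Fin 3)} {Q : EuclideanSpace ℝ (Fin 3) →ₗᵢ[ℝ] EuclideanSpace ℝ (Fin 3)}
    {τ s δ₀ : ℝ} {Y u z : EuclideanSpace ℝ (Fin 3)} (hτ0 : 0 ≤ τ) (hτ : τ ≤ 1 / 20) (hA : ∀ v, ‖A v - Q v‖ ≤ τ * ‖v‖) (hs : 0 < s)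
    (hsY : s ≤ ‖Y‖) (hu1 : ‖u‖ = 1) (hdeep : (1 - τ) * ‖Y‖ ≤ Real.sqrt 2 * (-⟪Y, A u⟫)) (hδ : 0 ≤ δ₀)
    (hz : ‖z - (Y + s • A u)‖ ≤ δ₀) (hfz : (2 * ‖Y‖ + 3 * s) * δ₀ ≤ s ^ 2 / 5) : ‖z‖ < ‖Y‖ := by
  refine nearer_of_deep hz ?_
  have hAu : ‖A u‖ ≤ 1 + τ := by
    calc ‖A u‖ = ‖Q u + (A u - Q u)‖ := by rw [add_sub_cancel]
      _ ≤ ‖Q u‖ + ‖A u - Q u‖ := norm_add_le _ _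
      _ ≤ ‖u‖ + τ * ‖u‖ := by rw [LinearIsometry.norm_map]; exact add_le_add le_rfl (hA u)
      _ = 1 + τ := by rw [hu1]; ring
  have hw : ‖s • A u‖ ≤ s * (1 + τ) := by
    rw [norm_smul, Real.norm_of_nonneg hs.le]; exact mul_le_mul_of_nonneg_left hAu hs.le
  have hw2 : ‖s • A u‖ ^ 2 ≤ (s * (1 + τ)) ^ 2 := pow_le_pow_left₀ (norm_nonneg _) hw 2
  have hYw : ‖Y + s • A u‖ ≤ ‖Y‖ + s * (1 + τ) := (norm_add_le _ _).trans (add_le_add le_rfl hw)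
  have hin : ⟪Y, s • A u⟫ = s * ⟪Y, A u⟫ := by rw [inner_smul_right]
  -- depth: `X := −⟪Y, A u⟫ ≥ (19/20)‖Y‖/√2`, so `X > (67/100)·s`
  have hneg : 0 ≤ -⟪Y, A u⟫ := by
    have h0 : 0 ≤ (1 - τ) * ‖Y‖ := mul_nonneg (by linarith) (norm_nonneg _)
    nlinarith [Real.sqrt_nonneg 2]
  have hX : (19 / 20) * ‖Y‖ ≤ Real.sqrt 2 * (-⟪Y, A u⟫) := by nlinarith [norm_nonneg Y]
  have hX2 : ((19 / 20) * ‖Y‖) ^ 2 ≤ 2 * (-⟪Y, A u⟫) ^ 2 := by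
    have h := pow_le_pow_left₀ (by positivity) hX 2
    have h2 : (Real.sqrt 2 * (-⟪Y, A u⟫)) ^ 2 = 2 * (-⟪Y, A u⟫) ^ 2 := by
      rw [mul_pow, Real.sq_sqrt (by norm_num : (0:ℝ) ≤ 2)]
    rw [h2] at h
    exact h
  have hXs : (67 / 100) * s < -⟪Y, A u⟫ := by
    by_contra h
    have h2 := pow_le_pow_left₀ hneg (not_lt.mp h) 2
    have hY2 : s ^ 2 ≤ ‖Y‖ ^ 2 := pow_le_pow_left₀ hs.le hsY 2
    nlinarith
  have hprod := mul_lt_mul_of_pos_left hXs hs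
  have hw3 : (s * (1 + τ)) ^ 2 ≤ (s * (21 / 20)) ^ 2 := pow_le_pow_left₀ (by positivity) (by nlinarith) 2
  have hfuzz : (2 * ‖Y + s • A u‖ + δ₀) * δ₀ ≤ (2 * ‖Y‖ + 3 * s) * δ₀ := by
    apply mul_le_mul_of_nonneg_right _ hδ
    have : δ₀ ≤ s / 2 := by nlinarith [norm_nonneg Y]
    nlinarith
  rw [hin]
  nlinarith

end Summit.AtomisticToContinuum.Crystallization.Theorems.OverbindingBudgetAffineFarSmoothSplit
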